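import Literature.NumberTheory.Automorphic.TraceZeroLatticeScaling
import Literature.NumberTheory.Automorphic.AdelicLatticeEscapeBoxCount
import Literature.MeasureTheory.Group.AddFundamentalDomainLatticeSum
import HarnessLib

/-!
# The centre-line lattice sum `Σ_{w ∈ E⁻∖0} F(λ w + s)` on the trace-zero adeles `𝔸_E⁻`: the CUSP bound (lattice sum minus
# normalised integral ≤ oscillation × module), the MIDDLE bound (uniformly finitely many terms) and the LOW regime (empty sum)
(Rogawski, *Automorphic Representations of Unitary Groups in Three Variables* (1990), §7.2 Prop. 7.2.1, p. 95: «the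
integrand … is absolutely integrable for every `T`»; Arthur, *A trace formula for reductive groups I*, Duke Math. J. 45
(1978), §8; Weil, *Adeles and algebraic groups* (1961/1982), Chap. I n° 12 Lemme 5)

Topic `NumberTheory/Automorphic`; namespace `Literature.NumberTheory.Automorphic.UnitaryGroup`. THEOREMS ONLY over accepted
tree modules (no definition, no named fact, no instance, no notation, no `sorry`). Brick (F6a) of the row (L5-iii-b2) (b2-β)
«`|b_T| ∈ L¹(Z B_γ(F)∖G(𝔸))` for every `T`» of the T1-qs LAW 5 road of `Cruxes/H413/Lines/F0_T1InnerFormTraceIdentity.lean`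
(cell `pub/hodgecm-mathlib`, crux H413). In torus coordinates Rogawski's bracket at the singular class `γ = d(a, b, a)` is
`Σ_{w ∈ E⁻∖0} F(λ_t w + s) − 1_{T<H(t)} · covol(E⁻)⁻¹ · χ⁻(λ_t)⁻¹ · ∫ F dμY` with `F(y) = f(k⁻¹ γ u(x, y) k)` (continuous, bounded,
supported in a fixed compact `C_Y ⊆ 𝔸_E⁻`), `λ_t = (d₀⁻¹d₂)(t)` a `c`-fixed idele acting on `𝔸_E⁻` (★ `smulTraceZero`) with module
`χ⁻(λ_t)` (★ `traceZeroModulus`), and a shift `s` in a fixed compact. This file is the GENERIC analysis of such sums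
(`F, λ, s` arbitrary), in three regimes of `λ`:

* plumbing ★ (F6a-1) `TraceZeroLatticeScaling`: `E⁻` meets compacta finitely, principal scalings permute `E⁻ ∖ 0` and have
  module `1`, `μY(λ⁻¹X) = χ⁻(λ)⁻¹ μY(X)`, `∫ F(λ y + s) = χ⁻(λ)⁻¹ ∫ F`.
* §2 **CUSP** `exists_const_norm_tsum_centreLine_sub_smul_integral_le`: ONE constant `D` (depending only on the compacta
  `C_Y, S₀, L₀` and on `𝓕⁻ = traceZeroFundamentalDomain`) with
  `‖Σ_{w ≠ 0} F(λ w + s) − (μY 𝓕⁻)⁻¹ χ⁻(λ)⁻¹ ∫ F‖ ≤ M + ω · χ⁻(λ)⁻¹ · D` for every `F` bounded by `M` and supported in `C_Y`,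
  every `s ∈ S₀`, every `λ` with `λ·ρ ∈ L₀` and every modulus `ω` of oscillation of `F` over the cells `λ ρ · 𝓕⁻` (`ρ` a principal
  `c`-fixed dilation of the fundamental domain, supplied by ★ (F5)) — Weil's Riemann-sum estimate ★ A-p12
  `norm_tsum_add_sub_smul_integral_le_of_isCompact` applied to `G(y) = F(λρ y + s)`.
* §3 **MIDDLE** `exists_nat_norm_tsum_centreLine_le`: for `λ⁻¹` in a compact `L₁`, `‖Σ_{w ≠ 0} F(λ w + s)‖ ≤ N₀ · M` (finitely many
  lattice points in a fixed compact, uniformly).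
* §4 **LOW** `exists_forall_tsum_centreLine_eq_zero`: for `‖λ‖_{𝔸_E}` large every `λ w`, `w ∈ E⁻ ∖ 0`, escapes `C_Y − S₀`
  (★ (P4) `exists_forall_mul_algebraMap_notMem` with `K := E`), so the sum is `0`.

## References
* J. D. Rogawski, *Automorphic Representations of Unitary Groups in Three Variables*, Ann. of Math. Stud. 123 (1990), §7.2
  Prop. 7.2.1 (pp. 93–95) [Rogawski1990].
* J. Arthur, *A trace formula for reductive groups I*, Duke Math. J. 45 (1978), §8 [Arthur1978TraceFormulaI].
* A. Weil, *Adeles and algebraic groups* (1982), Chap. I n° 12 Lemme 5 [Weil1965].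
* J. W. S. Cassels, A. Fröhlich (eds.), *Algebraic Number Theory* (1967), Ch. II §14 [CasselsFrohlichANT1967].
-/

set_option autoImplicit false

noncomputable section

open MeasureTheory Measure NumberField IsDedekindDomain Set Topology
open Literature.MeasureTheory.Group
open scoped NNReal ENNReal Pointwise

namespace Literature.NumberTheory.Automorphic

namespace UnitaryGroup

variable {F E : Type} [Field F] [Field E] [NumberField E] [Algebra F E] {c : E ≃ₐ[F] E}

/-- Pointwise differences of compact subsets of `𝔸_E⁻` are compact. [folklore] -/
private theorem isCompact_sub₆ {X Y : Set (traceZeroAdele F E c)} (hX : IsCompact X) (hY : IsCompact Y) :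
    IsCompact (X - Y) := by
  rw [sub_eq_add_neg]; exact hX.add hY.neg

/-! ## §2 The CUSP bound: lattice sum minus normalised integral is at most oscillation × module -/

section Cusp

variable [LocallyCompactSpace (AdeleRing (𝓞 E) E)] [MeasurableSpace (AdeleRing (𝓞 E) E)] [BorelSpace (AdeleRing (𝓞 E) E)]
  (μY : Measure (traceZeroAdele F E c)) [μY.IsAddHaarMeasure] [μY.Regular]

/-- **THE CUSP BOUND.** Fix compacta `C_Y, S₀ ⊆ 𝔸_E⁻`, `L₀ ⊆ 𝔸_E`. There is `D ≥ 0` such that for every measurable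
`F : 𝔸_E⁻ → ℂ` vanishing off `C_Y` with `‖F‖ ≤ M`, every `c`-fixed idele `λ` and principal `c`-fixed `r = ι(ρ)` with
`λ · r ∈ L₀`, every `s ∈ S₀` and every `ω ≥ 0` with `‖F(y) − F(y + λ r v)‖ ≤ ω` for `v ∈ 𝓕⁻`:
`‖Σ_{w ∈ E⁻∖0} F(λ w + s) − (μY 𝓕⁻)⁻¹ · χ⁻(λ)⁻¹ · ∫ F dμY‖ ≤ M + ω · χ⁻(λ)⁻¹ · D`. (Weil's Riemann-sum estimate ★
`norm_tsum_add_sub_smul_integral_le_of_isCompact` for `G(y) = F(λ r y + s)` over the cells `w + 𝓕⁻` of `E⁻`, re-indexing by `r`,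
`χ⁻(r) = 1`, the `w = 0` term `F(s)`, and `μY(λ⁻¹r⁻¹ · Y) = χ⁻(λ)⁻¹ μY(Y)`.)
[cite: Rogawski1990, §7.2 Prop. 7.2.1 (p. 95)] [cite: Weil1965, Chap. I n° 12 Lemme 5] [cite: Arthur1978TraceFormulaI, §8] -/
theorem exists_const_norm_tsum_centreLine_sub_smul_integral_le (hc : c * c = 1) (hc1 : c ≠ 1)
    {C_Y S₀ : Set (traceZeroAdele F E c)} (hC : IsCompact C_Y) (hS : IsCompact S₀)
    {L₀ : Set (AdeleRing (𝓞 E) E)} (hL : IsCompact L₀) :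
    ∃ D : ℝ, 0 ≤ D ∧
      ∀ (F' : traceZeroAdele F E c → ℂ), Measurable F' → (∀ y ∉ C_Y, F' y = 0) → ∀ M : ℝ, (∀ y, ‖F' y‖ ≤ M) →
      ∀ (l : (AdeleRing (𝓞 E) E)ˣ) (hl : conjAdele F E c (l : AdeleRing (𝓞 E) E) = l)
        (r : (AdeleRing (𝓞 E) E)ˣ) (hr : conjAdele F E c (r : AdeleRing (𝓞 E) E) = r),
        r ∈ GaloisRepresentations.principalIdeles E → (l : AdeleRing (𝓞 E) E) * (r : AdeleRing (𝓞 E) E) ∈ L₀ →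
      ∀ s ∈ S₀, ∀ ω : ℝ, 0 ≤ ω →
        (∀ y, ∀ v ∈ traceZeroFundamentalDomain F E c,
          ‖F' y - F' (y + smulTraceZero l hl (smulTraceZero r hr v))‖ ≤ ω) →
        ‖(∑' w : {w : rationalTraceZero F E c // w ≠ 0}, F' (smulTraceZero l hl (w.1 : traceZeroAdele F E c) + s)) -
            (((μY (traceZeroFundamentalDomain F E c)).toReal⁻¹ * ((traceZeroModulus l hl : ℝ≥0) : ℝ)⁻¹) •
              ∫ y, F' y ∂μY)‖ ≤
          M + ω * ((traceZeroModulus l hl : ℝ≥0) : ℝ)⁻¹ * D := by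
  classical
  haveI := locallyCompactSpace_traceZeroAdele (F := F) (E := E) (c := c)
  haveI := secondCountableTopology_adeleRing E
  haveI : SecondCountableTopology (traceZeroAdele F E c) := TopologicalSpace.Subtype.secondCountableTopology _
  haveI := countable_rationalTraceZero (F := F) (E := E) (c := c)
  -- the fundamental domain `P = 𝓕⁻`
  set P : Set (traceZeroAdele F E c) := traceZeroFundamentalDomain F E c with hPdef
  have hP : IsAddFundamentalDomain (rationalTraceZero F E c) P μY := isAddFundamentalDomain_traceZeroFundamentalDomain hc μY
  obtain ⟨Pc, hPcc, hPsub⟩ := exists_isCompact_traceZeroFundamentalDomain_subset (F := F) (E := E) (c := c) hc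
  have hPc : IsCompact (closure P) := hPcc.closure_of_subset hPsub
  have hP0 : μY P ≠ 0 := by
    intro h0
    have := hP.measure_ne_zero (μ := μY) (NeZero.ne μY)
    exact this h0
  -- the compact `K₂ ⊇ (λ r) · (P̄ − ({0} ∪ P̄))` for `λ r ∈ L₀ ∩ {c-fixed}` and `Y = (C_Y − S₀) + K₂`
  have hLf : IsCompact (L₀ ∩ (fixedAdele F E c : Set (AdeleRing (𝓞 E) E))) := hL.inter_right isClosed_fixedAdele
  set Z : Set (traceZeroAdele F E c) := closure P - insert (0 : traceZeroAdele F E c) (closure P) with hZ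
  have hZc : IsCompact Z := isCompact_sub₆ hPc (hPc.insert 0)
  set K₂ : Set (traceZeroAdele F E c) :=
    (fun p : ↥(L₀ ∩ (fixedAdele F E c : Set (AdeleRing (𝓞 E) E))) × traceZeroAdele F E c =>
      (⟨(p.1 : AdeleRing (𝓞 E) E) * (p.2 : AdeleRing (𝓞 E) E), by
        have h1 := (mem_fixedAdele_iff _).1 p.1.2.2
        have h2 := (mem_traceZeroAdele_iff _).1 p.2.2
        rw [mem_traceZeroAdele_iff, map_mul, h1, h2, mul_neg]⟩ : traceZeroAdele F E c)) '' (univ ×ˢ Z) with hK₂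
  have hK₂c : IsCompact K₂ := by
    haveI : CompactSpace ↥(L₀ ∩ (fixedAdele F E c : Set (AdeleRing (𝓞 E) E))) := isCompact_iff_compactSpace.1 hLf
    refine (isCompact_univ.prod hZc).image ?_
    exact ((continuous_subtype_val.comp continuous_fst).mul (continuous_subtype_val.comp continuous_snd)).subtype_mk _
  set Y : Set (traceZeroAdele F E c) := (C_Y - S₀) + K₂ with hY
  refine ⟨(μY Y).toReal / (μY P).toReal, by positivity, fun F' hF'm hF'C M hM l hl r hr hrp hL₀ s hs ω hω0 hω => ?_⟩
  have hM0 : 0 ≤ M := (norm_nonneg _).trans (hM 0)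
  -- the combined scaling `e = λ r`
  have hlr : conjAdele F E c ((l * r : (AdeleRing (𝓞 E) E)ˣ) : AdeleRing (𝓞 E) E) = (l * r : (AdeleRing (𝓞 E) E)ˣ) := by
    rw [Units.val_mul, map_mul, hl, hr]
  set e := smulTraceZero (F := F) (c := c) (l * r) hlr with hedef
  have he : ∀ y, e y = smulTraceZero l hl (smulTraceZero r hr y) := fun y =>
    Subtype.ext (by change ((l * r : (AdeleRing (𝓞 E) E)ˣ) : AdeleRing (𝓞 E) E) * y = l * (r * y); rw [Units.val_mul, mul_assoc])
  have hmodr : traceZeroModulus r hr = 1 := traceZeroModulus_eq_one_of_mem_principalIdeles hc hc1 hr hrp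
  have hmod : traceZeroModulus (F := F) (c := c) (l * r) hlr = traceZeroModulus l hl := by
    rw [traceZeroModulus_mul l r hl hr hlr, hmodr, mul_one]
  -- the function `G(y) = F(e y + s)` on `𝔸_E⁻`
  set G : traceZeroAdele F E c → ℂ := fun y => F' (e y + s) with hGdef
  have hGm : Measurable G := hF'm.comp ((e.continuous.add continuous_const).measurable)
  set C_G : Set (traceZeroAdele F E c) := (fun y => e y + s) ⁻¹' C_Y with hCG
  have hCGc : IsCompact C_G := by
    have h := (e.toHomeomorph.trans (Homeomorph.addRight s)).isCompact_preimage.2 hC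
    exact h
  have hGC : ∀ a ∉ C_G, G a = 0 := fun a ha => hF'C _ ha
  have hGbdd : ∀ a, ‖G a‖ ≤ M := fun a => hM _
  have hGi : Integrable G μY := by
    refine ⟨hGm.aestronglyMeasurable, ?_⟩
    refine IntegrableOn.integrable_of_forall_notMem_eq_zero (s := C_G) ?_ hGC |>.2
    exact Measure.integrableOn_of_bounded (M := M) hCGc.measure_lt_top.ne hGm.aestronglyMeasurable
      (ae_of_all _ fun a => hGbdd a)
  have hGω : ∀ a, ∀ v ∈ P, ‖G a - G (a + v)‖ ≤ ω := fun a v hv => by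
    simp only [hGdef, map_add, he]
    have := hω (smulTraceZero l hl (smulTraceZero r hr a) + s) v hv
    rwa [add_right_comm] at this
  -- Weil's estimate
  obtain ⟨hfinG, hest⟩ := norm_tsum_add_sub_smul_integral_le_of_isCompact (rationalTraceZero F E c) (μ := μY)
    (fun K hK => finite_setOf_rationalTraceZero_mem hK) hP hP0 hPc hCGc hGi hGC hω0 hGω 0
  simp only [add_zero] at hfinG hest
  -- summability of the lattice sum of `G`
  have hsum : Summable fun w : rationalTraceZero F E c => G (w : traceZeroAdele F E c) :=
    summable_of_hasFiniteSupport (hfinG.subset fun w hw => by simpa [Function.mem_support] using hw)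
  -- split off `w = 0`
  have hsplit : ∑' w : rationalTraceZero F E c, G (w : traceZeroAdele F E c) =
      G 0 + ∑' w : {w : rationalTraceZero F E c // w ≠ 0}, G (w.1 : traceZeroAdele F E c) := by
    rw [← hsum.sum_add_tsum_subtype_compl {0}, Finset.sum_singleton]
    congr 1
    exact (Equiv.subtypeEquivRight (fun w => by rw [Finset.mem_singleton])).tsum_eq
      (fun w : {w : rationalTraceZero F E c // w ≠ 0} => G (w.1 : traceZeroAdele F E c))
  -- re-index by `r` and identify the pieces
  have hreidx : ∑' w : {w : rationalTraceZero F E c // w ≠ 0}, G (w.1 : traceZeroAdele F E c) =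
      ∑' w : {w : rationalTraceZero F E c // w ≠ 0}, F' (smulTraceZero l hl (w.1 : traceZeroAdele F E c) + s) := by
    simp only [hGdef, he]
    exact tsum_ne_zero_comp_smulTraceZero_principal hr hrp (fun y => F' (smulTraceZero l hl y + s))
  have hint : ∫ y, G y ∂μY = (((traceZeroModulus l hl : ℝ≥0))⁻¹ : ℝ) • ∫ y, F' y ∂μY := by
    simp only [hGdef]
    rw [integral_comp_smulTraceZero_add_eq μY (l * r) hlr s F', hmod]
  have hG0 : ‖G 0‖ ≤ M := hGbdd 0
  -- the measure of Weil's set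
  have hYsub : (C_G - insert (0 : traceZeroAdele F E c) (closure P)) + closure P ⊆ e ⁻¹' Y := by
    rintro _ ⟨_, ⟨a, ha, z, hz, rfl⟩, p, hp, rfl⟩
    have hlrL : ((l * r : (AdeleRing (𝓞 E) E)ˣ) : AdeleRing (𝓞 E) E) ∈ L₀ ∩ (fixedAdele F E c : Set (AdeleRing (𝓞 E) E)) :=
      ⟨by rw [Units.val_mul]; exact hL₀, (mem_fixedAdele_iff _).2 hlr⟩
    refine ⟨e a + s - s, sub_mem_sub ha hs, e (p - z), ⟨(⟨_, hlrL⟩, p - z), ⟨mem_univ _, sub_mem_sub hp hz⟩, rfl⟩, ?_⟩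
    simp only [map_sub, map_add]
    abel
  have hYm : μY ((C_G - insert (0 : traceZeroAdele F E c) (closure P)) + closure P) ≤
      ((traceZeroModulus l hl)⁻¹ : ℝ≥0) * μY Y := by
    refine (measure_mono hYsub).trans ?_
    rw [measure_preimage_smulTraceZero_eq μY (l * r) hlr Y, hmod]
  have hYfin : μY Y < ∞ := ((isCompact_sub₆ hC hS).add hK₂c).measure_lt_top
  have hPfin : μY P < ∞ := measure_traceZeroFundamentalDomain_lt_top hc μY
  have hPpos : 0 < (μY P).toReal := ENNReal.toReal_pos hP0 hPfin.ne
  -- assemble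
  have key : ‖(∑' w : {w : rationalTraceZero F E c // w ≠ 0}, F' (smulTraceZero l hl (w.1 : traceZeroAdele F E c) + s)) -
      (((μY P).toReal⁻¹ * ((traceZeroModulus l hl : ℝ≥0) : ℝ)⁻¹) • ∫ y, F' y ∂μY)‖ ≤
      M + ω * ((μY ((C_G - insert (0 : traceZeroAdele F E c) (closure P)) + closure P)).toReal / (μY P).toReal) := by
    have h1 : (∑' w : {w : rationalTraceZero F E c // w ≠ 0}, F' (smulTraceZero l hl (w.1 : traceZeroAdele F E c) + s)) -
        (((μY P).toReal⁻¹ * ((traceZeroModulus l hl : ℝ≥0) : ℝ)⁻¹) • ∫ y, F' y ∂μY) =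
        ((∑' w : rationalTraceZero F E c, G (w : traceZeroAdele F E c)) - (μY P).toReal⁻¹ • ∫ y, G y ∂μY) - G 0 := by
      rw [hsplit, hreidx, hint, smul_smul]
      abel
    rw [h1]
    exact (norm_sub_le _ _).trans (by linarith [hest, hG0])
  refine key.trans ?_
  have hω' : ω * ((μY ((C_G - insert (0 : traceZeroAdele F E c) (closure P)) + closure P)).toReal / (μY P).toReal) ≤
      ω * ((traceZeroModulus l hl : ℝ≥0) : ℝ)⁻¹ * ((μY Y).toReal / (μY P).toReal) := by
    rw [mul_assoc]
    refine mul_le_mul_of_nonneg_left ?_ hω0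
    rw [← mul_div_assoc]
    refine div_le_div_of_nonneg_right ?_ hPpos.le
    have h := ENNReal.toReal_mono (ENNReal.mul_ne_top ENNReal.coe_ne_top hYfin.ne) hYm
    rwa [ENNReal.toReal_mul, ENNReal.coe_toReal, NNReal.coe_inv] at h
  linarith

end Cusp

/-! ## §3 The MIDDLE bound: finitely many terms, uniformly -/

section Middle

/-- **THE MIDDLE BOUND.** For compacta `C_Y, S₀ ⊆ 𝔸_E⁻` and `L₁ ⊆ 𝔸_E` there is `N₀ : ℕ` with
`‖Σ_{w ∈ E⁻∖0} F(λ w + s)‖ ≤ N₀ · M` whenever `F` vanishes off `C_Y`, `‖F‖ ≤ M`, `λ⁻¹ ∈ L₁` and `s ∈ S₀`: the charged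
lattice points `w` satisfy `w = λ⁻¹(λ w + s − s) ∈ (L₁ ∩ fixed) · (C_Y − S₀)`, a fixed compact meeting `E⁻` finitely.
[cite: Rogawski1990, §7.2 Prop. 7.2.1 (p. 95)] [cite: CasselsFrohlichANT1967, Ch. II §14 Theorem] -/
theorem exists_nat_norm_tsum_centreLine_le
    {C_Y S₀ : Set (traceZeroAdele F E c)} (hC : IsCompact C_Y) (hS : IsCompact S₀)
    {L₁ : Set (AdeleRing (𝓞 E) E)} (hL₁ : IsCompact L₁) :
    ∃ N₀ : ℕ, ∀ (F' : traceZeroAdele F E c → ℂ), (∀ y ∉ C_Y, F' y = 0) → ∀ M : ℝ, 0 ≤ M → (∀ y, ‖F' y‖ ≤ M) →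
      ∀ (l : (AdeleRing (𝓞 E) E)ˣ) (hl : conjAdele F E c (l : AdeleRing (𝓞 E) E) = l),
        ((l⁻¹ : (AdeleRing (𝓞 E) E)ˣ) : AdeleRing (𝓞 E) E) ∈ L₁ → ∀ s ∈ S₀,
        ‖∑' w : {w : rationalTraceZero F E c // w ≠ 0}, F' (smulTraceZero l hl (w.1 : traceZeroAdele F E c) + s)‖ ≤ N₀ * M := by
  classical
  -- the compact `K = (L₁ ∩ fixed) · (C_Y − S₀)` and the finite set of lattice points in it
  have hLf : IsCompact (L₁ ∩ (fixedAdele F E c : Set (AdeleRing (𝓞 E) E))) := hL₁.inter_right isClosed_fixedAdele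
  set K : Set (traceZeroAdele F E c) :=
    (fun p : ↥(L₁ ∩ (fixedAdele F E c : Set (AdeleRing (𝓞 E) E))) × traceZeroAdele F E c =>
      (⟨(p.1 : AdeleRing (𝓞 E) E) * (p.2 : AdeleRing (𝓞 E) E), by
        have h1 := (mem_fixedAdele_iff _).1 p.1.2.2
        have h2 := (mem_traceZeroAdele_iff _).1 p.2.2
        rw [mem_traceZeroAdele_iff, map_mul, h1, h2, mul_neg]⟩ : traceZeroAdele F E c)) '' (univ ×ˢ (C_Y - S₀)) with hK
  have hKc : IsCompact K := by
    haveI : CompactSpace ↥(L₁ ∩ (fixedAdele F E c : Set (AdeleRing (𝓞 E) E))) := isCompact_iff_compactSpace.1 hLf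
    refine (isCompact_univ.prod (isCompact_sub₆ hC hS)).image ?_
    exact ((continuous_subtype_val.comp continuous_fst).mul (continuous_subtype_val.comp continuous_snd)).subtype_mk _
  have hfin := finite_setOf_rationalTraceZero_mem (F := F) (E := E) (c := c) hKc
  refine ⟨hfin.toFinset.card, fun F' hF'C M hM0 hM l hl hL s hs => ?_⟩
  -- every charged `w` lies in the finite set
  have hsupp : ∀ w : {w : rationalTraceZero F E c // w ≠ 0},
      F' (smulTraceZero l hl (w.1 : traceZeroAdele F E c) + s) ≠ 0 → w.1 ∈ hfin.toFinset := by
    intro w hw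
    rw [Set.Finite.mem_toFinset, mem_setOf_eq]
    have hy : smulTraceZero l hl (w.1 : traceZeroAdele F E c) + s ∈ C_Y := by
      by_contra h; exact hw (hF'C _ h)
    have hfix : conjAdele F E c (((l⁻¹ : (AdeleRing (𝓞 E) E)ˣ)) : AdeleRing (𝓞 E) E) = ((l⁻¹ : (AdeleRing (𝓞 E) E)ˣ) : _) :=
      conjAdele_units_inv_of_fixed l hl
    refine ⟨(⟨_, hL, (mem_fixedAdele_iff _).2 hfix⟩, smulTraceZero l hl (w.1 : traceZeroAdele F E c) + s - s),
      ⟨mem_univ _, sub_mem_sub hy hs⟩, Subtype.ext ?_⟩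
    simp only [add_sub_cancel_right, coe_smulTraceZero]
    exact Units.inv_mul_cancel_left l _
  -- the sum is a finite sum of at most `N₀` terms each of norm `≤ M`
  have hfin' : (((↑) : {w : rationalTraceZero F E c // w ≠ 0} → rationalTraceZero F E c) ⁻¹'
      (hfin.toFinset : Set (rationalTraceZero F E c))).Finite :=
    (hfin.toFinset.finite_toSet).preimage Subtype.val_injective.injOn
  have hzero : ∀ w : {w : rationalTraceZero F E c // w ≠ 0}, w ∉ hfin'.toFinset →
      F' (smulTraceZero l hl (w.1 : traceZeroAdele F E c) + s) = 0 := by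
    intro w hw
    by_contra h
    exact hw ((Set.Finite.mem_toFinset _).2 (by simpa using hsupp w h))
  rw [tsum_eq_sum (s := hfin'.toFinset) (fun w hw => hzero w hw)]
  calc ‖∑ w ∈ hfin'.toFinset, F' (smulTraceZero l hl ((w : rationalTraceZero F E c) : traceZeroAdele F E c) + s)‖
      ≤ ∑ w ∈ hfin'.toFinset, ‖F' (smulTraceZero l hl ((w : rationalTraceZero F E c) : traceZeroAdele F E c) + s)‖ :=
        norm_sum_le _ _
    _ ≤ ∑ _w ∈ hfin'.toFinset, M := Finset.sum_le_sum fun w _ => hM _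
    _ = hfin'.toFinset.card * M := by rw [Finset.sum_const, nsmul_eq_mul]
    _ ≤ hfin.toFinset.card * M := by
        refine mul_le_mul_of_nonneg_right ?_ hM0
        have hle : hfin'.toFinset.card ≤ hfin.toFinset.card :=
          Finset.card_le_card_of_injOn (fun w : {w : rationalTraceZero F E c // w ≠ 0} => (w.1 : rationalTraceZero F E c))
            (fun w hw => (hfin'.mem_toFinset).1 (Finset.mem_coe.1 hw)) Subtype.val_injective.injOn
        exact_mod_cast hle

end Middle

/-! ## §4 The LOW regime: the lattice escapes, the sum is empty -/

section Low

/-- **THE LOW REGIME.** For compacta `C_Y, S₀ ⊆ 𝔸_E⁻` there is `c₀ ≥ 0` such that `Σ_{w ∈ E⁻∖0} F(λ w + s) = 0` whenever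
`‖λ‖_{𝔸_E} > c₀`, `s ∈ S₀` and `F` vanishes off `C_Y`: every `λ w = λ ι(ξ)`, `ξ ∈ Eˣ`, escapes the compact `C_Y − S₀`
(★ (P4) `exists_forall_mul_algebraMap_notMem` with `K := E`). [cite: Rogawski1990, §7.2 Prop. 7.2.1 (p. 95)]
[cite: CasselsFrohlichANT1967, Ch. II §12 Theorem (product formula)] -/
theorem exists_forall_tsum_centreLine_eq_zero
    {C_Y S₀ : Set (traceZeroAdele F E c)} (hC : IsCompact C_Y) (hS : IsCompact S₀) :
    ∃ c₀ : ℝ, 0 ≤ c₀ ∧ ∀ (l : (AdeleRing (𝓞 E) E)ˣ) (hl : conjAdele F E c (l : AdeleRing (𝓞 E) E) = l),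
      c₀ < (IdeleClassGroup.ideleNorm E l : ℝ) → ∀ s ∈ S₀, ∀ (F' : traceZeroAdele F E c → ℂ), (∀ y ∉ C_Y, F' y = 0) →
        ∀ w : {w : rationalTraceZero F E c // w ≠ 0}, F' (smulTraceZero l hl (w.1 : traceZeroAdele F E c) + s) = 0 := by
  have hK : IsCompact (((↑) : traceZeroAdele F E c → AdeleRing (𝓞 E) E) '' (C_Y - S₀)) :=
    (isCompact_sub₆ hC hS).image continuous_subtype_val
  obtain ⟨c₀, hc₀, hesc⟩ := exists_forall_mul_algebraMap_notMem (K := E) hK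
  refine ⟨c₀, hc₀, fun l hl hlt s hs F' hF'C w => hF'C _ fun hmem => ?_⟩
  obtain ⟨ξ, hξ⟩ := (mem_rationalTraceZero_iff _).1 w.1.2
  have hξ0 : ξ ≠ 0 := by
    intro h0
    apply w.2
    refine Subtype.ext (Subtype.ext ?_)
    rw [← hξ, h0, map_zero]; rfl
  refine hesc l hlt (Units.mk0 ξ hξ0) ⟨smulTraceZero l hl (w.1 : traceZeroAdele F E c) + s - s, sub_mem_sub hmem hs, ?_⟩
  rw [add_sub_cancel_right, coe_smulTraceZero, Units.val_mk0, hξ]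

/-- The same as the vanishing of the `tsum`. [cite: Rogawski1990, §7.2 Prop. 7.2.1 (p. 95)] -/
theorem exists_forall_tsum_centreLine_eq_zero'
    {C_Y S₀ : Set (traceZeroAdele F E c)} (hC : IsCompact C_Y) (hS : IsCompact S₀) :
    ∃ c₀ : ℝ, 0 ≤ c₀ ∧ ∀ (l : (AdeleRing (𝓞 E) E)ˣ) (hl : conjAdele F E c (l : AdeleRing (𝓞 E) E) = l),
      c₀ < (IdeleClassGroup.ideleNorm E l : ℝ) → ∀ s ∈ S₀, ∀ (F' : traceZeroAdele F E c → ℂ), (∀ y ∉ C_Y, F' y = 0) →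
        ∑' w : {w : rationalTraceZero F E c // w ≠ 0}, F' (smulTraceZero l hl (w.1 : traceZeroAdele F E c) + s) = 0 := by
  obtain ⟨c₀, hc₀, h⟩ := exists_forall_tsum_centreLine_eq_zero (F := F) (E := E) (c := c) hC hS
  exact ⟨c₀, hc₀, fun l hl hlt s hs F' hF'C => by simp only [h l hl hlt s hs F' hF'C, tsum_zero]⟩

end Low

end UnitaryGroup

end Literature.NumberTheory.Automorphic

end
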